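import Mathlib
import HarnessLib
import Summits.CriticalPhenomena.PercolationContinuityZ3.Theorems.PercNearOneGluingNoHeavyLowerTailTwoCopyGadget
import Summits.CriticalPhenomena.PercolationContinuityZ3.Theorems.PercNearOneGluingNoHeavyLowerTailTwoCopyTwistedProduct

/-!
# Designated edges: positivity of the glued two-copy form from a coupling (graded LEMMA G) and for comparable gadgets

Helper file for crux `stmt-CriticalPhenomena-4575` (new-inequality factory `prim-ineq-gen-1`, gen 17); memo
`run/shared/lean/prim/prim-ineq-gen-1/FINDING-23-designated-edges.md` §1–§2.  Builds on `…TwoCopyGadget.lean` (gen 16: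
`gadget_identity`, `edge_expansion`) and `…TwoCopyTwistedProduct.lean` (sections of monotone events).

SETTING (as in `TwoCopyGadget`).  Side 1 (`Ω₁`, a preorder = configurations of `G₁` ordered by inclusion) carries the two
weights `w0` (gadget does not join the glue pair `u,w`) and `wt` (it does) and the two Boolean events `U0`, `Up`; the gadget
`Ω₂` carries weights `w₂ ≥ 0` and the Boolean `c₂ = [u ~ w in the gadget]`.  The glued two-copy Harris form against a Boolean `V`
on `Ω₁ × Ω₂` is `gH V`, and `gadget_identity` splits it into the (dd), (cc) and mixed groups built from the side-1 forms
`H1 w0 U0`, `H1 wt Up`, `S0`, `S1` evaluated at the SECTIONS `V(·, η)`.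

THE DESIGNATED-EDGE PROPERTY `Designated w0 wt U0 Up` (memo: `𝒬`; 'the virtual edge `uw` is fibrewise'): for all monotone
`V`, `V₀ ≤ V₁`:  `0 ≤ H1 w0 U0 V`,  `0 ≤ H1 wt Up V`,  `0 ≤ S0 V₀ + S1 V₁`.  By `edge_expansion` this says exactly that the
two-copy form of `G₁ + g` (virtual edge `g = uw` of weight `t`) is nonnegative COEFFICIENTWISE IN `t` — for graphs: coefficientwise
in `q` and in `y_g` (e.g. the Wheatstone bridge w.r.t. its rung, by THEOREM W of FINDING-22; every two-terminal series–parallel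
pair w.r.t. any edge, by THEOREM A).

RESULTS (this work 2026-08-21).
* `coupling_gadget_nonneg` — the algebraic skeleton of LEMMA G INCLUDING the coupling step: if `π ≥ 0` on `Ω₂ × Ω₂` is supported
  on pairs `η ≤ η'` with `¬c₂ η`, `c₂ η'` and has the marginals `Σ_{η'} π η η' = C·w₂ η` on `d` and `Σ_η π η η' = D·w₂ η'` on `c`
  (`C = Σ_c w₂`, `D = Σ_d w₂`; such a `π` is a monotone (Strassen) coupling of the gadget's two conditional laws, and for the
  GRADED statement it exists degree by degree exactly when the gadget is a good side — memo §1), then `Designated` implies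
  `0 ≤ gH V` for every monotone `V`.  Over `R = ℝ[q]` (coefficientwise order) this is the GRADED LEMMA G of the memo.
* `comparable_gadget_nonneg` — when every non-joining gadget configuration lies below every joining one (single edge, parallel
  bundles, series paths), the product coupling works: `Designated ⟹ 0 ≤ gH V` for every monotone `V`, over any ordered commutative
  ring; with `R` a polynomial ring this is positivity coefficientwise in the gadget's own edge variables.  Instances:
  `edge_nonneg` (one edge), `parallelPair_nonneg` (two parallel edges), `seriesPair_nonneg` (a path of length two).  Iterating the
  last two along a series–parallel decomposition is THEOREM B of the memo (fibrewise substitution of a TTSP network for a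
  designated edge); only the single step is formalised here.
-/

namespace Summit.CriticalPhenomena.PercolationContinuityZ3.Theorems

namespace TwoCopyDesignated

open Finset TwoCopyGadget TwoCopyTwistedProduct

variable {R : Type*} [CommRing R] [PartialOrder R] [IsOrderedRing R]
variable {Ω₁ Ω₂ : Type*} [Fintype Ω₁] [Fintype Ω₂] [Preorder Ω₁] [Preorder Ω₂]

/-- The designated-edge property `𝒬` of an interface `(w0, wt, U0, Up)`: the three coefficient forms of the single-edge
expansion are nonnegative on (nested pairs of) up-sets. [this work] -/
structure Designated (w0 wt : Ω₁ → R) (U0 Up : Ω₁ → Bool) : Prop where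
  /-- `H_{G₁}(U⁰, V) ≥ 0` for every up-set `V` -/
  h0 : ∀ V : Ω₁ → Bool, Monotone V → 0 ≤ H1 w0 U0 V
  /-- `H_{G₁/uw}(U⁺, V) ≥ 0` for every up-set `V` -/
  ht : ∀ V : Ω₁ → Bool, Monotone V → 0 ≤ H1 wt Up V
  /-- the mixed form `S₀(V₀) + S₁(V₁) ≥ 0` for nested up-sets `V₀ ≤ V₁` -/
  hS : ∀ V₀ V₁ : Ω₁ → Bool, Monotone V₀ → Monotone V₁ → V₀ ≤ V₁ → 0 ≤ S0 w0 wt U0 Up V₀ + S1 w0 wt U0 Up V₁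

variable (w0 wt : Ω₁ → R) (U0 Up : Ω₁ → Bool) (w₂ : Ω₂ → R) (c₂ : Ω₂ → Bool)

/-- Weight restricted to the gadget's `d`-class. [this work] -/
def dd : Ω₂ → R := fun η => if c₂ η then 0 else w₂ η

/-- Weight restricted to the gadget's `c`-class. [this work] -/
def cc : Ω₂ → R := fun η => if c₂ η then w₂ η else 0

omit [PartialOrder R] [IsOrderedRing R] [Preorder Ω₂] in
/-- `dsum f = Σ_η dd η · f η`. [this work] -/
theorem dsum_eq (f : Ω₂ → R) : dsum w₂ c₂ f = ∑ η, dd w₂ c₂ η * f η := by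
  unfold dsum dd
  refine Finset.sum_congr rfl fun η _ => ?_
  split_ifs <;> ring

omit [PartialOrder R] [IsOrderedRing R] [Preorder Ω₂] in
/-- `csum f = Σ_η cc η · f η`. [this work] -/
theorem csum_eq (f : Ω₂ → R) : csum w₂ c₂ f = ∑ η, cc w₂ c₂ η * f η := by
  unfold csum cc
  refine Finset.sum_congr rfl fun η _ => ?_
  split_ifs <;> ring

omit [IsOrderedRing R] [Fintype Ω₂] [Preorder Ω₂] in
/-- `dd ≥ 0` when `w₂ ≥ 0`. [this work] -/
theorem dd_nonneg (hw₂ : ∀ η, 0 ≤ w₂ η) (η : Ω₂) : 0 ≤ dd w₂ c₂ η := by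
  unfold dd; split_ifs
  · exact le_rfl
  · exact hw₂ η

omit [IsOrderedRing R] [Fintype Ω₂] [Preorder Ω₂] in
/-- `cc ≥ 0` when `w₂ ≥ 0`. [this work] -/
theorem cc_nonneg (hw₂ : ∀ η, 0 ≤ w₂ η) (η : Ω₂) : 0 ≤ cc w₂ c₂ η := by
  unfold cc; split_ifs
  · exact hw₂ η
  · exact le_rfl

omit [Preorder Ω₂] in
/-- A `d`-class sum of nonnegative terms is nonnegative. [this work] -/
theorem dsum_nonneg (hw₂ : ∀ η, 0 ≤ w₂ η) {f : Ω₂ → R} (hf : ∀ η, 0 ≤ f η) : 0 ≤ dsum w₂ c₂ f := by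
  rw [dsum_eq]
  exact Finset.sum_nonneg fun η _ => mul_nonneg (dd_nonneg w₂ c₂ hw₂ η) (hf η)

omit [Preorder Ω₂] in
/-- A `c`-class sum of nonnegative terms is nonnegative. [this work] -/
theorem csum_nonneg (hw₂ : ∀ η, 0 ≤ w₂ η) {f : Ω₂ → R} (hf : ∀ η, 0 ≤ f η) : 0 ≤ csum w₂ c₂ f := by
  rw [csum_eq]
  exact Finset.sum_nonneg fun η _ => mul_nonneg (cc_nonneg w₂ c₂ hw₂ η) (hf η)

/-- THE COUPLING FORM OF LEMMA G.  If a nonnegative `π` on `Ω₂ × Ω₂` couples the `d`-class (scaled by `C`) with the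
`c`-class (scaled by `D`) along nested pairs `η ≤ η'`, then the designated-edge property of side 1 makes the glued two-copy form
nonnegative for every up-set `V`. [this work] -/
theorem coupling_gadget_nonneg (hQ : Designated w0 wt U0 Up) (hw₂ : ∀ η, 0 ≤ w₂ η)
    (π : Ω₂ → Ω₂ → R) (hπ : ∀ η η', 0 ≤ π η η')
    (hsupp : ∀ η η', π η η' ≠ 0 → η ≤ η')
    (hrow : ∀ η, ∑ η', π η η' = csum w₂ c₂ (fun _ => 1) * dd w₂ c₂ η)
    (hcol : ∀ η', ∑ η, π η η' = dsum w₂ c₂ (fun _ => 1) * cc w₂ c₂ η')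
    (V : Ω₁ × Ω₂ → Bool) (hV : Monotone V) :
    0 ≤ gH w0 wt U0 Up w₂ c₂ V := by
  rw [gadget_identity]
  have hsec : ∀ η, Monotone fun ω₁ => V (ω₁, η) := fun η => monotone_section_left hV η
  -- (dd) and (cc) groups
  have t1 : 0 ≤ dsum w₂ c₂ (fun _ => (1 : R)) * dsum w₂ c₂ (fun η => H1 w0 U0 fun ω₁ => V (ω₁, η)) :=
    mul_nonneg (dsum_nonneg w₂ c₂ hw₂ fun _ => zero_le_one)
      (dsum_nonneg w₂ c₂ hw₂ fun η => hQ.h0 _ (hsec η))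
  have t2 : 0 ≤ csum w₂ c₂ (fun _ => (1 : R)) * csum w₂ c₂ (fun η => H1 wt Up fun ω₁ => V (ω₁, η)) :=
    mul_nonneg (csum_nonneg w₂ c₂ hw₂ fun _ => zero_le_one)
      (csum_nonneg w₂ c₂ hw₂ fun η => hQ.ht _ (hsec η))
  -- the mixed group as a π-average of nested mixed forms
  have m1 : csum w₂ c₂ (fun _ => (1 : R)) * dsum w₂ c₂ (fun η => S0 w0 wt U0 Up fun ω₁ => V (ω₁, η))
      = ∑ η, ∑ η', π η η' * S0 w0 wt U0 Up (fun ω₁ => V (ω₁, η)) := by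
    rw [dsum_eq, Finset.mul_sum]
    refine Finset.sum_congr rfl fun η _ => ?_
    rw [← Finset.sum_mul, hrow η]
    ring
  have m2 : dsum w₂ c₂ (fun _ => (1 : R)) * csum w₂ c₂ (fun η' => S1 w0 wt U0 Up fun ω₁ => V (ω₁, η'))
      = ∑ η, ∑ η', π η η' * S1 w0 wt U0 Up (fun ω₁ => V (ω₁, η')) := by
    rw [csum_eq, Finset.mul_sum, Finset.sum_comm]
    refine Finset.sum_congr rfl fun η' _ => ?_
    rw [← Finset.sum_mul, hcol η']
    ring
  have t3 : 0 ≤ csum w₂ c₂ (fun _ => (1 : R)) * dsum w₂ c₂ (fun η => S0 w0 wt U0 Up fun ω₁ => V (ω₁, η))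
      + dsum w₂ c₂ (fun _ => (1 : R)) * csum w₂ c₂ (fun η' => S1 w0 wt U0 Up fun ω₁ => V (ω₁, η')) := by
    rw [m1, m2, ← Finset.sum_add_distrib]
    refine Finset.sum_nonneg fun η _ => ?_
    rw [← Finset.sum_add_distrib]
    refine Finset.sum_nonneg fun η' _ => ?_
    rw [← mul_add]
    by_cases hz : π η η' = 0
    · rw [hz, zero_mul]
    · refine mul_nonneg (hπ η η') (hQ.hS _ _ (hsec η) (hsec η') ?_)
      intro ω₁
      exact hV (Prod.mk_le_mk.mpr ⟨le_rfl, hsupp η η' hz⟩)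
  have e : dsum w₂ c₂ (fun _ => (1 : R)) * dsum w₂ c₂ (fun η => H1 w0 U0 fun ω₁ => V (ω₁, η))
        + csum w₂ c₂ (fun _ => (1 : R)) * csum w₂ c₂ (fun η => H1 wt Up fun ω₁ => V (ω₁, η))
        + csum w₂ c₂ (fun _ => (1 : R)) * dsum w₂ c₂ (fun η => S0 w0 wt U0 Up fun ω₁ => V (ω₁, η))
        + dsum w₂ c₂ (fun _ => (1 : R)) * csum w₂ c₂ (fun η' => S1 w0 wt U0 Up fun ω₁ => V (ω₁, η'))
      = (dsum w₂ c₂ (fun _ => (1 : R)) * dsum w₂ c₂ (fun η => H1 w0 U0 fun ω₁ => V (ω₁, η))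
        + csum w₂ c₂ (fun _ => (1 : R)) * csum w₂ c₂ (fun η => H1 wt Up fun ω₁ => V (ω₁, η)))
        + (csum w₂ c₂ (fun _ => (1 : R)) * dsum w₂ c₂ (fun η => S0 w0 wt U0 Up fun ω₁ => V (ω₁, η))
        + dsum w₂ c₂ (fun _ => (1 : R)) * csum w₂ c₂ (fun η' => S1 w0 wt U0 Up fun ω₁ => V (ω₁, η'))) := by ring
  rw [e]
  exact add_nonneg (add_nonneg t1 t2) t3

/-- COMPARABLE GADGETS.  If every gadget configuration that does not join `u,w` lies below every configuration that does
(single edge, parallel bundles, series paths), the product coupling `π η η' = dd η · cc η'` satisfies the hypotheses of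
`coupling_gadget_nonneg`; hence `Designated ⟹ 0 ≤ gH V` for every up-set `V`, over any ordered commutative ring. [this work] -/
theorem comparable_gadget_nonneg (hQ : Designated w0 wt U0 Up) (hw₂ : ∀ η, 0 ≤ w₂ η)
    (hcmp : ∀ η η', c₂ η = false → c₂ η' = true → η ≤ η')
    (V : Ω₁ × Ω₂ → Bool) (hV : Monotone V) :
    0 ≤ gH w0 wt U0 Up w₂ c₂ V := by
  refine coupling_gadget_nonneg w0 wt U0 Up w₂ c₂ hQ hw₂ (fun η η' => dd w₂ c₂ η * cc w₂ c₂ η')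
    (fun η η' => mul_nonneg (dd_nonneg w₂ c₂ hw₂ η) (cc_nonneg w₂ c₂ hw₂ η')) ?_ ?_ ?_ V hV
  · intro η η' hne
    by_cases hc : c₂ η = true
    · exfalso; apply hne; unfold dd; simp [hc]
    by_cases hc' : c₂ η' = true
    · exact hcmp η η' (by simpa using hc) hc'
    · exfalso; apply hne; unfold cc; simp [hc']
  · intro η
    rw [← Finset.mul_sum, csum_eq]
    have : ∑ η', cc w₂ c₂ η' * (1 : R) = ∑ η', cc w₂ c₂ η' := Finset.sum_congr rfl fun _ _ => mul_one _
    rw [this]; ring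
  · intro η'
    rw [← Finset.sum_mul, dsum_eq]
    have : ∑ η, dd w₂ c₂ η * (1 : R) = ∑ η, dd w₂ c₂ η := Finset.sum_congr rfl fun _ _ => mul_one _
    rw [this]

section Instances

variable {w0 wt U0 Up}

/-- A single edge of weight `t ≥ 0` (`Ω₂ = Bool`, joining iff present): `Designated ⟹ 0 ≤ H_{G₁+g}(U, V)` for every up-set `V`
of `Ω₁ × Bool` — with `R` a polynomial ring in `t`, positivity coefficientwise in `t` (cf. `edge_expansion`). [this work] -/
theorem edge_nonneg (hQ : Designated w0 wt U0 Up) {t : R} (ht : 0 ≤ t)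
    (V : Ω₁ × Bool → Bool) (hV : Monotone V) :
    0 ≤ gH w0 wt U0 Up (fun b : Bool => if b then t else 1) (fun b => b) V := by
  refine comparable_gadget_nonneg w0 wt U0 Up _ _ hQ ?_ ?_ V hV
  · intro η; cases η <;> simp [ht]
  · intro η η' h h'
    cases η <;> cases η' <;> simp_all

/-- Two parallel edges of weights `s₁, s₂ ≥ 0` (`Ω₂ = Bool × Bool`, joining iff at least one is present): the only non-joining
configuration is the bottom one, so `Designated ⟹ 0 ≤ gH V` for every up-set `V`; with `R = R₀[s₁,s₂]` this is positivity
coefficientwise in both new edge variables (parallel step of THEOREM B). [this work] -/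
theorem parallelPair_nonneg (hQ : Designated w0 wt U0 Up) {s₁ s₂ : R} (hs₁ : 0 ≤ s₁) (hs₂ : 0 ≤ s₂)
    (V : Ω₁ × (Bool × Bool) → Bool) (hV : Monotone V) :
    0 ≤ gH w0 wt U0 Up (fun η : Bool × Bool => (if η.1 then s₁ else 1) * (if η.2 then s₂ else 1))
      (fun η => η.1 || η.2) V := by
  refine comparable_gadget_nonneg w0 wt U0 Up _ _ hQ ?_ ?_ V hV
  · rintro ⟨b₁, b₂⟩
    cases b₁ <;> cases b₂ <;> simp [hs₁, hs₂, mul_nonneg]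
  · rintro ⟨b₁, b₂⟩ ⟨b₁', b₂'⟩ h h'
    cases b₁ <;> cases b₂ <;> simp_all

/-- A path of length two with edge weights `s₁, s₂ ≥ 0` and a factor `κ ≥ 0` (for graphs: `q`, the isolated middle vertex) on
the empty configuration (`Ω₂ = Bool × Bool`, joining iff both edges are present): the only joining configuration is the top one,
so `Designated ⟹ 0 ≤ gH V` for every up-set `V` (series step of THEOREM B). [this work] -/
theorem seriesPair_nonneg (hQ : Designated w0 wt U0 Up) {s₁ s₂ κ : R} (hs₁ : 0 ≤ s₁) (hs₂ : 0 ≤ s₂) (hκ : 0 ≤ κ)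
    (V : Ω₁ × (Bool × Bool) → Bool) (hV : Monotone V) :
    0 ≤ gH w0 wt U0 Up
      (fun η : Bool × Bool => (if η.1 then s₁ else 1) * (if η.2 then s₂ else 1) * (if η.1 || η.2 then 1 else κ))
      (fun η => η.1 && η.2) V := by
  refine comparable_gadget_nonneg w0 wt U0 Up _ _ hQ ?_ ?_ V hV
  · rintro ⟨b₁, b₂⟩
    cases b₁ <;> cases b₂ <;> simp [hs₁, hs₂, hκ, mul_nonneg]
  · rintro ⟨b₁, b₂⟩ ⟨b₁', b₂'⟩ h h'
    cases b₁' <;> cases b₂' <;> simp_all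

end Instances

/-! ## The two generating steps as interface transformations (THEOREM B, induction steps)

Appended 2026-08-21 (gen 17).  THEOREM B iterates two operations on a designated (virtual) edge `g = uw`; to iterate, each step must
return an INTERFACE that is again `Designated`.  PARALLEL step (`parW0`, `parWt`, `parU0`, `parUp`): a concrete edge of weight `s`
is glued parallel to the virtual edge; configurations `Ω₁ × Bool` (the Boolean = the new edge is open).  SERIES step (`serW0`, `serWt`,
`serU0`, `serUp`): the virtual edge `uw` is replaced by a new vertex `m`, a concrete edge `mw` of weight `s` (Boolean coordinate) and the
NEW virtual edge `um`; `κ` (= `q` for graphs) weights the configuration in which `m` is isolated.  `designated_par` and `designated_ser`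
prove that `Designated` is preserved (for `s, κ ≥ 0` in any ordered commutative ring — hence coefficientwise when `R` is a polynomial
ring), via the explicit expansions `par_H0`, `par_Ht`, `par_S`, `ser_H0`, `ser_Ht`, `ser_S` of the three forms of the new interface
as nonnegative combinations of the old forms at nested arguments (memo FINDING-23 §1.4). -/

section Steps

variable {w0 wt U0 Up}

omit [PartialOrder R] [IsOrderedRing R] [Preorder Ω₁] in
/-- Restricted sums over `Ω₁ × Bool` split into the two Boolean slices. [this work] -/
theorem zs_prod_bool (f : Ω₁ × Bool → R) (P : Ω₁ × Bool → Bool) :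
    zs f P = zs (fun ω => f (ω, false)) (fun ω => P (ω, false)) + zs (fun ω => f (ω, true)) (fun ω => P (ω, true)) := by
  unfold zs
  rw [Fintype.sum_prod_type_right, Fintype.sum_bool, add_comm]

/-- PARALLEL step, plain weight: `w0` if the new edge is closed, `s·wt` if it is open (then `u ~ w`). [this work] -/
def parW0 (w0 wt : Ω₁ → R) (s : R) : Ω₁ × Bool → R := fun ω => if ω.2 then s * wt ω.1 else w0 ω.1
/-- PARALLEL step, pinched weight: `wt`, times `s` if the new edge is open. [this work] -/
def parWt (wt : Ω₁ → R) (s : R) : Ω₁ × Bool → R := fun ω => if ω.2 then s * wt ω.1 else wt ω.1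
/-- PARALLEL step, event without the virtual edge: `Up` if the new edge is open, else `U0`. [this work] -/
def parU0 (U0 Up : Ω₁ → Bool) : Ω₁ × Bool → Bool := fun ω => if ω.2 then Up ω.1 else U0 ω.1
/-- PARALLEL step, event with the virtual edge: `Up`. [this work] -/
def parUp (Up : Ω₁ → Bool) : Ω₁ × Bool → Bool := fun ω => Up ω.1

/-- SERIES step, plain weight (virtual `um` absent): `κ·w0` if `mw` is closed (`m` isolated), `s·w0` if open. [this work] -/
def serW0 (w0 : Ω₁ → R) (s κ : R) : Ω₁ × Bool → R := fun ω => if ω.2 then s * w0 ω.1 else κ * w0 ω.1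
/-- SERIES step, pinched weight (`u = m`): `s·wt` if `mw` is open (then `u ~ w`), `w0` if closed. [this work] -/
def serWt (w0 wt : Ω₁ → R) (s : R) : Ω₁ × Bool → R := fun ω => if ω.2 then s * wt ω.1 else w0 ω.1
/-- SERIES step, event without the virtual edge `um`: `U0`. [this work] -/
def serU0 (U0 : Ω₁ → Bool) : Ω₁ × Bool → Bool := fun ω => U0 ω.1
/-- SERIES step, event with the virtual edge `um`: `Up` if `mw` is open, else `U0`. [this work] -/
def serUp (U0 Up : Ω₁ → Bool) : Ω₁ × Bool → Bool := fun ω => if ω.2 then Up ω.1 else U0 ω.1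

omit [PartialOrder R] [IsOrderedRing R] [Preorder Ω₁] in
/-- `Z_{c·w}[P] = c · Z_w[P]`. [this work] -/
theorem zs_smul (c : R) (f : Ω₁ → R) (P : Ω₁ → Bool) : zs (fun ω => c * f ω) P = c * zs f P := by
  unfold zs; rw [Finset.mul_sum]; refine Finset.sum_congr rfl fun ω _ => ?_; split_ifs <;> ring

omit [PartialOrder R] [IsOrderedRing R] [Preorder Ω₁] in
/-- PARALLEL step, first form: `H1 (parW0) (parU0) V = H⁰(V₀) + s·S(V₀,V₁) + s²·H̃(V₁)` (= `edge_expansion`). [this work] -/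
theorem par_H0 (s : R) (V : Ω₁ × Bool → Bool) :
    H1 (parW0 w0 wt s) (parU0 U0 Up) V
      = H1 w0 U0 (fun ω => V (ω, false))
        + s * (S0 w0 wt U0 Up (fun ω => V (ω, false)) + S1 w0 wt U0 Up (fun ω => V (ω, true)))
        + s ^ 2 * H1 wt Up (fun ω => V (ω, true)) := by
  unfold H1 S0 S1
  simp only [zs_prod_bool (parW0 w0 wt s)]
  simp only [parW0, parU0, Bool.false_eq_true, if_false, if_true, zs_smul]
  ring

omit [PartialOrder R] [IsOrderedRing R] [Preorder Ω₁] in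
/-- PARALLEL step, second form: `H1 (parWt) (parUp) V = (1+s)·(H̃(V₀) + s·H̃(V₁))`. [this work] -/
theorem par_Ht (s : R) (V : Ω₁ × Bool → Bool) :
    H1 (parWt wt s) (parUp Up) V
      = (1 + s) * (H1 wt Up (fun ω => V (ω, false)) + s * H1 wt Up (fun ω => V (ω, true))) := by
  unfold H1
  simp only [zs_prod_bool (parWt wt s)]
  simp only [parWt, parUp, Bool.false_eq_true, if_false, if_true, zs_smul]
  ring

omit [PartialOrder R] [IsOrderedRing R] [Preorder Ω₁] in
/-- PARALLEL step, mixed form: `S'(V₀',V₁') = S(V₀₀,V₁₀) + s·(S(V₀₀,V₁₁) + H̃(V₀₁) + H̃(V₁₀)) + s²·(H̃(V₀₁) + H̃(V₁₁))`. [this work] -/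
theorem par_S (s : R) (V0 V1 : Ω₁ × Bool → Bool) :
    S0 (parW0 w0 wt s) (parWt wt s) (parU0 U0 Up) (parUp Up) V0 + S1 (parW0 w0 wt s) (parWt wt s) (parU0 U0 Up) (parUp Up) V1
      = (S0 w0 wt U0 Up (fun ω => V0 (ω, false)) + S1 w0 wt U0 Up (fun ω => V1 (ω, false)))
        + s * ((S0 w0 wt U0 Up (fun ω => V0 (ω, false)) + S1 w0 wt U0 Up (fun ω => V1 (ω, true)))
                + H1 wt Up (fun ω => V0 (ω, true)) + H1 wt Up (fun ω => V1 (ω, false)))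
        + s ^ 2 * (H1 wt Up (fun ω => V0 (ω, true)) + H1 wt Up (fun ω => V1 (ω, true))) := by
  unfold H1 S0 S1
  simp only [zs_prod_bool (parW0 w0 wt s), zs_prod_bool (parWt wt s)]
  simp only [parW0, parWt, parU0, parUp, Bool.false_eq_true, if_false, if_true, zs_smul]
  ring

omit [PartialOrder R] [IsOrderedRing R] [Preorder Ω₁] in
/-- SERIES step, first form: `H1 (serW0) (serU0) V = (κ+s)·(κ·H⁰(V₀) + s·H⁰(V₁))`. [this work] -/
theorem ser_H0 (s κ : R) (V : Ω₁ × Bool → Bool) :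
    H1 (serW0 w0 s κ) (serU0 U0) V
      = (κ + s) * (κ * H1 w0 U0 (fun ω => V (ω, false)) + s * H1 w0 U0 (fun ω => V (ω, true))) := by
  unfold H1
  simp only [zs_prod_bool (serW0 w0 s κ)]
  simp only [serW0, serU0, Bool.false_eq_true, if_false, if_true, zs_smul]
  ring

omit [PartialOrder R] [IsOrderedRing R] [Preorder Ω₁] in
/-- SERIES step, second form: `H1 (serWt) (serUp) V = H⁰(V₀) + s·S(V₀,V₁) + s²·H̃(V₁)`. [this work] -/
theorem ser_Ht (s : R) (V : Ω₁ × Bool → Bool) :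
    H1 (serWt w0 wt s) (serUp U0 Up) V
      = H1 w0 U0 (fun ω => V (ω, false))
        + s * (S0 w0 wt U0 Up (fun ω => V (ω, false)) + S1 w0 wt U0 Up (fun ω => V (ω, true)))
        + s ^ 2 * H1 wt Up (fun ω => V (ω, true)) := by
  unfold H1 S0 S1
  simp only [zs_prod_bool (serWt w0 wt s)]
  simp only [serWt, serUp, Bool.false_eq_true, if_false, if_true, zs_smul]
  ring

omit [PartialOrder R] [IsOrderedRing R] [Preorder Ω₁] in
/-- SERIES step, mixed form: `S' = κ·(H⁰(V₀₀)+H⁰(V₁₀)) + κs·S(V₀₀,V₁₁) + s·(H⁰(V₀₁)+H⁰(V₁₀)) + s²·S(V₀₁,V₁₁)`. [this work] -/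
theorem ser_S (s κ : R) (V0 V1 : Ω₁ × Bool → Bool) :
    S0 (serW0 w0 s κ) (serWt w0 wt s) (serU0 U0) (serUp U0 Up) V0 + S1 (serW0 w0 s κ) (serWt w0 wt s) (serU0 U0) (serUp U0 Up) V1
      = κ * (H1 w0 U0 (fun ω => V0 (ω, false)) + H1 w0 U0 (fun ω => V1 (ω, false)))
        + κ * s * (S0 w0 wt U0 Up (fun ω => V0 (ω, false)) + S1 w0 wt U0 Up (fun ω => V1 (ω, true)))
        + s * (H1 w0 U0 (fun ω => V0 (ω, true)) + H1 w0 U0 (fun ω => V1 (ω, false)))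
        + s ^ 2 * (S0 w0 wt U0 Up (fun ω => V0 (ω, true)) + S1 w0 wt U0 Up (fun ω => V1 (ω, true))) := by
  unfold H1 S0 S1
  simp only [zs_prod_bool (serW0 w0 s κ), zs_prod_bool (serWt w0 wt s)]
  simp only [serW0, serWt, serU0, serUp, Bool.false_eq_true, if_false, if_true, zs_smul]
  ring

omit [Fintype Ω₁] in
/-- Monotone Booleans on `Ω₁ × Bool`: both slices are monotone and the `false` slice lies below the `true` slice. [this work] -/
theorem slices_of_monotone {V : Ω₁ × Bool → Bool} (hV : Monotone V) :
    Monotone (fun ω => V (ω, false)) ∧ Monotone (fun ω => V (ω, true)) ∧ (fun ω => V (ω, false)) ≤ fun ω => V (ω, true) :=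
  ⟨monotone_section_left hV false, monotone_section_left hV true,
    fun _ => hV (Prod.mk_le_mk.mpr ⟨le_rfl, Bool.false_le _⟩)⟩

/-- THEOREM B, PARALLEL STEP: gluing a concrete edge of weight `s ≥ 0` parallel to the designated virtual edge preserves `Designated`.
[this work] -/
theorem designated_par (hQ : Designated w0 wt U0 Up) {s : R} (hs : 0 ≤ s) :
    Designated (parW0 w0 wt s) (parWt wt s) (parU0 U0 Up) (parUp Up) := by
  refine ⟨fun V hV => ?_, fun V hV => ?_, fun V0 V1 hV0 hV1 hle => ?_⟩
  · obtain ⟨h0, h1, hle⟩ := slices_of_monotone hV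
    rw [par_H0]
    exact add_nonneg (add_nonneg (hQ.h0 _ h0) (mul_nonneg hs (hQ.hS _ _ h0 h1 hle)))
      (mul_nonneg (pow_nonneg hs 2) (hQ.ht _ h1))
  · obtain ⟨h0, h1, _⟩ := slices_of_monotone hV
    rw [par_Ht]
    exact mul_nonneg (add_nonneg zero_le_one hs) (add_nonneg (hQ.ht _ h0) (mul_nonneg hs (hQ.ht _ h1)))
  · obtain ⟨a0, a1, ale⟩ := slices_of_monotone hV0
    obtain ⟨b0, b1, ble⟩ := slices_of_monotone hV1
    have h00 : (fun ω => V0 (ω, false)) ≤ fun ω => V1 (ω, false) := fun ω => hle (ω, false)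
    have h01 : (fun ω => V0 (ω, false)) ≤ fun ω => V1 (ω, true) := fun ω => le_trans (hle (ω, false)) (ble ω)
    rw [par_S]
    refine add_nonneg (add_nonneg (hQ.hS _ _ a0 b0 h00) (mul_nonneg hs ?_)) (mul_nonneg (pow_nonneg hs 2) ?_)
    · exact add_nonneg (add_nonneg (hQ.hS _ _ a0 b1 h01) (hQ.ht _ a1)) (hQ.ht _ b0)
    · exact add_nonneg (hQ.ht _ a1) (hQ.ht _ b1)

/-- THEOREM B, SERIES STEP: subdividing the designated virtual edge `uw` into a new virtual edge `um` and a concrete edge `mw` of weight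
`s ≥ 0` (factor `κ ≥ 0` when `m` is isolated) preserves `Designated` (now at the pair `u, m`). [this work] -/
theorem designated_ser (hQ : Designated w0 wt U0 Up) {s κ : R} (hs : 0 ≤ s) (hκ : 0 ≤ κ) :
    Designated (serW0 w0 s κ) (serWt w0 wt s) (serU0 U0) (serUp U0 Up) := by
  refine ⟨fun V hV => ?_, fun V hV => ?_, fun V0 V1 hV0 hV1 hle => ?_⟩
  · obtain ⟨h0, h1, _⟩ := slices_of_monotone hV
    rw [ser_H0]
    exact mul_nonneg (add_nonneg hκ hs) (add_nonneg (mul_nonneg hκ (hQ.h0 _ h0)) (mul_nonneg hs (hQ.h0 _ h1)))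
  · obtain ⟨h0, h1, hle⟩ := slices_of_monotone hV
    rw [ser_Ht]
    exact add_nonneg (add_nonneg (hQ.h0 _ h0) (mul_nonneg hs (hQ.hS _ _ h0 h1 hle)))
      (mul_nonneg (pow_nonneg hs 2) (hQ.ht _ h1))
  · obtain ⟨a0, a1, ale⟩ := slices_of_monotone hV0
    obtain ⟨b0, b1, ble⟩ := slices_of_monotone hV1
    have h01 : (fun ω => V0 (ω, false)) ≤ fun ω => V1 (ω, true) := fun ω => le_trans (hle (ω, false)) (ble ω)
    have h11 : (fun ω => V0 (ω, true)) ≤ fun ω => V1 (ω, true) := fun ω => hle (ω, true)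
    rw [ser_S]
    refine add_nonneg (add_nonneg (add_nonneg ?_ ?_) ?_) ?_
    · exact mul_nonneg hκ (add_nonneg (hQ.h0 _ a0) (hQ.h0 _ b0))
    · exact mul_nonneg (mul_nonneg hκ hs) (hQ.hS _ _ a0 b1 h01)
    · exact mul_nonneg hs (add_nonneg (hQ.h0 _ a1) (hQ.h0 _ b0))
    · exact mul_nonneg (pow_nonneg hs 2) (hQ.hS _ _ a1 b1 h11)

end Steps

end TwoCopyDesignated

end Summit.CriticalPhenomena.PercolationContinuityZ3.Theorems
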